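import Summits.BirchSwinnertonDyer.BirchSwinnertonDyer.Theorems.EisensteinPrimesKatzLineDescentRelation
import HarnessLib

/-!
# Values ⇒ the formal ODE of the `λ`-descent (AN-F₂, route (RIG)): if `Q(u^k − 1) = d^k·L(u^k − 1)`
# for all `k ≥ 1`, then `‖d‖ = 1` and `(1+T)·(Q·L′ − Q′·L) + a·Q·L = 0` in `ℂ_p⟦T⟧`
# (helper file for crux 2 `GoodLatticeBDPValue`, stmt-BirchSwinnertonDyer-19032, line `halves`, stub 3
# `stub_anDS`, piece AN-F₂ `KatzLineDescentAt` of `Cruxes/GoodLatticeBDPValue/Lines/halves_anDS_split_idea11g4.lean`;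
# seat `bsd-line-x1-p1-w3` gen 2)

THE ANALYTIC STEP of the different-period rigidity (RIG). Two CGLS-type frames `Q`, `L` of one
`θ_K` at period pairs `(Ω_K', Ω_p')`, `(Ω_K'', Ω_p'')`, read along the powers `φ₁^k` of one
interpolation character, satisfy `Q(x_k) = d^k · L(x_k)` at `x_k = u^k − 1` (`u = φ̂₁(γ)` a principal
unit of infinite order, `d = c^{2n₁}`, `c = ι⁻¹(Ω_K''/Ω_K')·Ω_p'/Ω_p''`). For bounded `Q, L ∈ ℂ_p⟦T⟧`
(`Q ≠ 0`) and ANY `u, d ∈ ℂ_p` with `‖u − 1‖ < 1`, `u^{p^j} ≠ 1` this file proves: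

* (previous file `…KatzLineDescentRelation`: the first-order expansion `norm_keyRelation_le` of the
  relation at `x_k` along `x_{k+p^j} = x_k + u^k(u^{p^j} − 1)`, a non-zero value of `Q`, and the
  trichotomy `‖d‖ = 1`, `d^{p^j} → 1`.)
* `norm_coeff_wronskian_le`, `hasSum_coeff_wronskian`: coefficient bound and value of the Wronskian
  combination `(1+T)·(Q·L′ − Q′·L) + a·Q·L`;
* `exists_ode_of_relation`: there is `a ∈ ℂ_p` (the limit of `(d^{p^j} − 1)/(u^{p^j} − 1)`) with
  the FORMAL identity `(1+T)·(Q·L′ − Q′·L) + a·Q·L = 0` in `ℂ_p⟦T⟧` — the hypothesis of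
  `…KatzLineDescentWronskian.exists_eq_C_mul_binomialSeries_mul_of_ode`, which then gives
  `L = c·(1+T)^{−a}·Q`.

Pure `p`-adic analysis; no fact, no definition, no `sorry`; nothing about BSD.
References: Washington 1997 §5.1, §7.1–7.2; Cassels 1986 Ch. 4 Thm. 4.1 (Strassmann); Koblitz 1984 Ch. IV §1.
-/

-- the summit namespace `Summit.BirchSwinnertonDyer.BirchSwinnertonDyer` repeats the problem name by design (D-0017)
set_option linter.dupNamespace false
set_option autoImplicit false

noncomputable section

open scoped Classical Topology

open Filter Finset PowerSeries
open Summit.BirchSwinnertonDyer.Rank1Residual.X11b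

namespace Summit.BirchSwinnertonDyer.BirchSwinnertonDyer.Theorems.KatzLineDescent

variable {p : ℕ} [Fact p.Prime]

/-! ## The formal ODE -/

section ODE

variable {Q L : PowerSeries ℂ_[p]} {C : ℝ} {u d : ℂ_[p]}

/-- Coefficients of the Wronskian combination `(1+T)·(Q·L′ − Q′·L) + a·Q·L` are bounded (by
`max(C², ‖a‖C²)`). [cite: Koblitz1984, Ch. IV §1] -/
theorem norm_coeff_wronskian_le (hQ : ∀ n, ‖coeff n Q‖ ≤ C) (hL : ∀ n, ‖coeff n L‖ ≤ C) (a : ℂ_[p])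
    (n : ℕ) :
    ‖coeff n ((1 + X) * (Q * d⁄dX ℂ_[p] L - d⁄dX ℂ_[p] Q * L) + PowerSeries.C a * (Q * L))‖ ≤
      max (C * C) (‖a‖ * (C * C)) := by
  have hD : ∀ n, ‖coeff n (Q * d⁄dX ℂ_[p] L - d⁄dX ℂ_[p] Q * L)‖ ≤ C * C := by
    intro n
    have := norm_coeff_sub_le (norm_coeff_mul_le hQ (norm_coeff_derivative_le hL))
      (norm_coeff_mul_le (norm_coeff_derivative_le hQ) hL) n
    rwa [max_self] at this
  have hXD : ∀ n, ‖coeff n ((1 + X) * (Q * d⁄dX ℂ_[p] L - d⁄dX ℂ_[p] Q * L))‖ ≤ C * C := by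
    intro n
    rw [add_mul, one_mul]
    have := norm_coeff_add_le hD (norm_coeff_X_mul_le hD) n
    rwa [max_self] at this
  exact norm_coeff_add_le hXD (norm_coeff_C_mul_le (norm_coeff_mul_le hQ hL) a) n

/-- **The value of the Wronskian combination** at a point `y` of the open disc:
`((1+T)(QL′ − Q′L) + aQL)(y) = (1+y)(Q(y)L′(y) − Q′(y)L(y)) + a·Q(y)L(y)`.
[cite: Koblitz1984, Ch. IV §1] -/
theorem hasSum_coeff_wronskian (hQ : ∀ n, ‖coeff n Q‖ ≤ C) (hL : ∀ n, ‖coeff n L‖ ≤ C) (a : ℂ_[p])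
    {y : ℂ_[p]} (hy : ‖y‖ < 1) :
    HasSum (fun n ↦ coeff n ((1 + X) * (Q * d⁄dX ℂ_[p] L - d⁄dX ℂ_[p] Q * L) +
        PowerSeries.C a * (Q * L)) * y ^ n)
      ((1 + y) * ((∑' n, coeff n Q * y ^ n) * (∑' n, coeff (n + 1) L * (n + 1) * y ^ n) -
          (∑' n, coeff (n + 1) Q * (n + 1) * y ^ n) * ∑' n, coeff n L * y ^ n) +
        a * ((∑' n, coeff n Q * y ^ n) * ∑' n, coeff n L * y ^ n)) := by
  set D := Q * d⁄dX ℂ_[p] L - d⁄dX ℂ_[p] Q * L with hDdef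
  have hQ' := norm_coeff_derivative_le hQ
  have hL' := norm_coeff_derivative_le hL
  have eQ' : ∑' n, coeff n (d⁄dX ℂ_[p] Q) * y ^ n = ∑' n, coeff (n + 1) Q * (n + 1) * y ^ n :=
    (hasSum_coeff_derivative hQ hy).tsum_eq
  have eL' : ∑' n, coeff n (d⁄dX ℂ_[p] L) * y ^ n = ∑' n, coeff (n + 1) L * (n + 1) * y ^ n :=
    (hasSum_coeff_derivative hL hy).tsum_eq
  -- value of `D`
  have hDval : HasSum (fun n ↦ coeff n D * y ^ n)
      ((∑' n, coeff n Q * y ^ n) * (∑' n, coeff (n + 1) L * (n + 1) * y ^ n) -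
        (∑' n, coeff (n + 1) Q * (n + 1) * y ^ n) * ∑' n, coeff n L * y ^ n) := by
    have h1 := hasSum_coeff_mul hQ hL' hy
    have h2 := hasSum_coeff_mul hQ' hL hy
    rw [eL'] at h1
    rw [eQ'] at h2
    refine (h1.sub h2).congr_fun fun n ↦ ?_
    rw [hDdef, map_sub, sub_mul]
  have hDbd : ∀ n, ‖coeff n D‖ ≤ C * C := by
    intro n
    have := norm_coeff_sub_le (norm_coeff_mul_le hQ hL') (norm_coeff_mul_le hQ' hL) n
    rwa [max_self] at this
  -- value of `X * D`
  have hXD := hasSum_coeff_X_mul hDbd hy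
  rw [hDval.tsum_eq] at hXD
  -- value of `C a * (Q * L)`
  have hQL := hasSum_coeff_C_mul (norm_coeff_mul_le hQ hL) hy a
  rw [(hasSum_coeff_mul hQ hL hy).tsum_eq] at hQL
  -- assemble
  have htot := (hDval.add hXD).add hQL
  convert htot using 1
  · funext n
    rw [show (1 + X) * D = D + X * D by ring, map_add, map_add]
    ring
  · ring

/-- **VALUES ⇒ THE FORMAL ODE.** Let `Q, L ∈ ℂ_p⟦T⟧` have bounded coefficients, `Q ≠ 0`, let `u` be
a principal unit (`‖u − 1‖ < 1`) with `u^{p^j} ≠ 1` for all `j`, and `d ∈ ℂ_p`. If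
`Q(u^k − 1) = d^k · L(u^k − 1)` for every `k ≥ 1`, then `‖d‖ = 1` and there is `a ∈ ℂ_p` with
`(1+T)·(Q·L′ − Q′·L) + a·Q·L = 0` in `ℂ_p⟦T⟧`.
Proof: by `norm_keyRelation_le` along `x_{k+p^j} → x_k` and the trichotomy, `‖d‖ = 1` and
`d^{p^j} → 1`; dividing the key relation by `u^k(u^{p^j} − 1)`, the ratios
`s_j = (d^{p^j} − 1)/(u^{p^j} − 1)` converge (read at a node where `Q ≠ 0`) to some `a`, and at every
node `(d/u)^k L(x_k)·a = Q′(x_k) − d^k L′(x_k)`; multiplying by `u^k L(x_k) = (1 + x_k)L(x_k)` and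
using `Q(x_k) = d^k L(x_k)` this is the vanishing of the Wronskian combination at `x_k`; the identity
principle along `x_{p^j} → 0` makes it vanish identically.
[cite: Washington1997, §5.1, §7.1–7.2] [cite: Cassels1986, Ch. 4 Thm. 4.1] -/
theorem exists_ode_of_relation (hQ : ∀ n, ‖coeff n Q‖ ≤ C) (hL : ∀ n, ‖coeff n L‖ ≤ C)
    (hQ0 : Q ≠ 0) (hu : ‖u - 1‖ < 1) (hu' : ∀ j : ℕ, u ^ p ^ j ≠ 1)
    (hrel : ∀ k : ℕ, 1 ≤ k →
      ∑' n, coeff n Q * (u ^ k - 1) ^ n = d ^ k * ∑' n, coeff n L * (u ^ k - 1) ^ n) :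
    ‖d‖ = 1 ∧ ∃ a : ℂ_[p],
      (1 + X) * (Q * d⁄dX ℂ_[p] L - d⁄dX ℂ_[p] Q * L) + PowerSeries.C a * (Q * L) = 0 := by
  have hC : 0 ≤ C := (norm_nonneg _).trans (hQ 0)
  -- the values as functions of the point
  set f : ℂ_[p] → ℂ_[p] := fun y ↦ ∑' n, coeff n Q * y ^ n with hf
  set g : ℂ_[p] → ℂ_[p] := fun y ↦ ∑' n, coeff n L * y ^ n with hg
  set f' : ℂ_[p] → ℂ_[p] := fun y ↦ ∑' n, coeff (n + 1) Q * (n + 1) * y ^ n with hf'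
  set g' : ℂ_[p] → ℂ_[p] := fun y ↦ ∑' n, coeff (n + 1) L * (n + 1) * y ^ n with hg'
  set x : ℕ → ℂ_[p] := fun k ↦ u ^ k - 1 with hx
  set ε : ℕ → ℂ_[p] := fun j ↦ u ^ p ^ j - 1 with hε
  have hx1 : ∀ k, ‖x k‖ < 1 := fun k ↦ (R1.norm_pow_sub_one_le hu k).trans_lt hu
  have hu1 : ‖u‖ = 1 := R1.norm_eq_one_of_norm_sub_one_lt hu
  have hu0 : u ≠ 0 := fun h ↦ by simp [h] at hu1
  have huk : ∀ k : ℕ, ‖u ^ k‖ = 1 := fun k ↦ by rw [norm_pow, hu1, one_pow]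
  have hε0 : ∀ j, ε j ≠ 0 := fun j ↦ sub_ne_zero.mpr (hu' j)
  have hε1 : ∀ j, ‖ε j‖ < 1 := fun j ↦ hx1 (p ^ j)
  have hεlim : Tendsto ε atTop (𝓝 0) := by
    have h := (tendsto_pow_prime_pow_padicComplex hu).sub_const 1
    rwa [sub_self] at h
  have hP1 : ∀ j : ℕ, 1 ≤ p ^ j := fun j ↦ Nat.one_le_pow _ _ (Fact.out : p.Prime).pos
  have hrel' : ∀ k, 1 ≤ k → f (x k) = d ^ k * g (x k) := fun k hk ↦ hrel k hk
  -- bounds on the derivative values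
  have hf'b : ∀ k, ‖f' (x k)‖ ≤ C := fun k ↦
    norm_tsum_mul_pow_le (c := fun n : ℕ ↦ coeff (n + 1) Q * ((n : ℂ_[p]) + 1))
      (norm_deriv_coeff_le hQ) (hx1 k)
  have hg'b : ∀ k, ‖g' (x k)‖ ≤ C := fun k ↦
    norm_tsum_mul_pow_le (c := fun n : ℕ ↦ coeff (n + 1) L * ((n : ℂ_[p]) + 1))
      (norm_deriv_coeff_le hL) (hx1 k)
  -- the key relation at every `k ≥ 1`, `j`
  have hkey : ∀ k, 1 ≤ k → ∀ j,
      ‖d ^ k * (d ^ p ^ j - 1) * g (x k) - u ^ k * ε j * (f' (x k) - d ^ (k + p ^ j) * g' (x k))‖ ≤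
        C * ‖u ^ k * ε j‖ ^ 2 * (1 + ‖d‖ ^ (k + p ^ j)) := by
    intro k hk j
    exact norm_keyRelation_le hQ hL hu (hrel k hk) (hrel (k + p ^ j) (hk.trans (Nat.le_add_right k _)))
  -- a node where `Q ≠ 0`
  obtain ⟨k₀, hk₀, hf₀⟩ := exists_tsum_ne_zero hQ hQ0 hu hu'
  have hf₀' : f (x k₀) ≠ 0 := hf₀
  have hg₀ : g (x k₀) ≠ 0 := by
    intro h0; apply hf₀'; rw [hrel' k₀ hk₀, h0, mul_zero]
  have hd0 : d ≠ 0 := by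
    intro h0; apply hf₀'
    rw [hrel' k₀ hk₀, h0, zero_pow (by omega), zero_mul]
  -- `‖d‖ = 1` and `d^{p^j} → 1`
  have hbound : ∀ j : ℕ, ‖d‖ ^ k₀ * ‖d ^ p ^ j - 1‖ * ‖g (x k₀)‖ ≤
      2 * C * ‖ε j‖ * max 1 (‖d‖ ^ (k₀ + p ^ j)) := fun j ↦
    norm_pow_mul_norm_sub_one_mul_le (huk k₀) (hε1 j).le (hf'b k₀) (hg'b k₀) (hkey k₀ hk₀ j)
  obtain ⟨hd1, hdlim⟩ := norm_eq_one_and_tendsto_of_bound hg₀ hd0 hεlim hbound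
  refine ⟨hd1, ?_⟩
  -- the error terms `T j k := (d/u)^k g_k s_j − (f'_k − d^k d^{p^j} g'_k)` tend to `0`
  set s : ℕ → ℂ_[p] := fun j ↦ (d ^ p ^ j - 1) / ε j with hs
  have hT : ∀ k, 1 ≤ k → Tendsto (fun j ↦ (d / u) ^ k * g (x k) * s j -
      (f' (x k) - d ^ k * d ^ p ^ j * g' (x k))) atTop (𝓝 0) := by
    intro k hk
    have hb : ∀ j, ‖(d / u) ^ k * g (x k) * s j - (f' (x k) - d ^ k * d ^ p ^ j * g' (x k))‖ ≤
        2 * C * ‖ε j‖ := by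
      intro j
      have hεj : ε j ≠ 0 := hε0 j
      have huk0 : u ^ k ≠ 0 := pow_ne_zero _ hu0
      have hid : (d / u) ^ k * g (x k) * s j - (f' (x k) - d ^ k * d ^ p ^ j * g' (x k)) =
          (u ^ k * ε j)⁻¹ * (d ^ k * (d ^ p ^ j - 1) * g (x k) -
            u ^ k * ε j * (f' (x k) - d ^ (k + p ^ j) * g' (x k))) := by
        simp only [hs, pow_add, div_pow]
        field_simp
      rw [hid, norm_mul, norm_inv]
      have hn : ‖u ^ k * ε j‖ = ‖ε j‖ := by rw [norm_mul, huk, one_mul]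
      rw [hn]
      have hεpos : 0 < ‖ε j‖ := norm_pos_iff.mpr (hε0 j)
      rw [inv_mul_le_iff₀ hεpos]
      refine (hkey k hk j).trans ?_
      rw [hn, hd1, one_pow]
      have : ‖ε j‖ ^ 2 ≤ ‖ε j‖ * ‖ε j‖ := by rw [sq]
      nlinarith [norm_nonneg (ε j)]
    have hlim : Tendsto (fun j ↦ 2 * C * ‖ε j‖) atTop (𝓝 0) := by
      have := (tendsto_norm_zero.comp hεlim).const_mul (2 * C)
      simpa using this
    exact squeeze_zero_norm hb hlim
  -- the ratios `s_j` converge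
  set a : ℂ_[p] := (f' (x k₀) - d ^ k₀ * g' (x k₀)) / ((d / u) ^ k₀ * g (x k₀)) with ha
  have hden : (d / u) ^ k₀ * g (x k₀) ≠ 0 :=
    mul_ne_zero (pow_ne_zero _ (div_ne_zero hd0 hu0)) hg₀
  have hslim : Tendsto s atTop (𝓝 a) := by
    have h1 : Tendsto (fun j ↦ f' (x k₀) - d ^ k₀ * d ^ p ^ j * g' (x k₀)) atTop
        (𝓝 (f' (x k₀) - d ^ k₀ * g' (x k₀))) := by
      have := ((hdlim.const_mul (d ^ k₀)).mul_const (g' (x k₀))).const_sub (f' (x k₀))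
      simpa using this
    have h2 := ((hT k₀ hk₀).add h1).div_const ((d / u) ^ k₀ * g (x k₀))
    rw [zero_add] at h2
    refine h2.congr' (Eventually.of_forall fun j ↦ ?_)
    show ((d / u) ^ k₀ * g (x k₀) * s j - (f' (x k₀) - d ^ k₀ * d ^ p ^ j * g' (x k₀)) +
        (f' (x k₀) - d ^ k₀ * d ^ p ^ j * g' (x k₀))) / ((d / u) ^ k₀ * g (x k₀)) = s j
    rw [sub_add_cancel]
    exact mul_div_cancel_left₀ _ hden
  -- the relation `(K_k)` at every node
  have hK : ∀ k, 1 ≤ k → (d / u) ^ k * g (x k) * a = f' (x k) - d ^ k * g' (x k) := by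
    intro k hk
    have h1 : Tendsto (fun j ↦ (d / u) ^ k * g (x k) * s j) atTop (𝓝 ((d / u) ^ k * g (x k) * a)) :=
      hslim.const_mul _
    have h2 : Tendsto (fun j ↦ (d / u) ^ k * g (x k) * s j) atTop
        (𝓝 (f' (x k) - d ^ k * g' (x k))) := by
      have h3 : Tendsto (fun j ↦ f' (x k) - d ^ k * d ^ p ^ j * g' (x k)) atTop
          (𝓝 (f' (x k) - d ^ k * g' (x k))) := by
        have := ((hdlim.const_mul (d ^ k)).mul_const (g' (x k))).const_sub (f' (x k))
        simpa using this
      have := (hT k hk).add h3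
      rw [zero_add] at this
      refine this.congr' (Eventually.of_forall fun j ↦ ?_)
      show (d / u) ^ k * g (x k) * s j - (f' (x k) - d ^ k * d ^ p ^ j * g' (x k)) +
        (f' (x k) - d ^ k * d ^ p ^ j * g' (x k)) = (d / u) ^ k * g (x k) * s j
      rw [sub_add_cancel]
    exact tendsto_nhds_unique h1 h2
  -- the Wronskian combination vanishes at every node
  refine ⟨a, ?_⟩
  set W := (1 + X) * (Q * d⁄dX ℂ_[p] L - d⁄dX ℂ_[p] Q * L) + PowerSeries.C a * (Q * L) with hW
  have hWval : ∀ k, 1 ≤ k → HasSum (fun n ↦ coeff n W * x k ^ n) 0 := by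
    intro k hk
    have h := hasSum_coeff_wronskian hQ hL a (hx1 k)
    have hzero : (1 + x k) * (f (x k) * g' (x k) - f' (x k) * g (x k)) + a * (f (x k) * g (x k)) = 0 := by
      have h1 : 1 + x k = u ^ k := by rw [hx]; ring
      have h2 := hK k hk
      rw [h1, hrel' k hk]
      rw [div_pow] at h2
      have hu2 : u ^ k ≠ 0 := pow_ne_zero _ hu0
      field_simp at h2
      linear_combination g (x k) * h2
    rw [hzero] at h
    exact h
  -- identity principle along `x (p^j) = ε j → 0`
  have hc := eq_zero_of_norm_le_of_hasSum_zero_of_tendsto_zero (norm_coeff_wronskian_le hQ hL a)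
    hεlim (Frequently.of_forall hε0) fun j ↦ hWval (p ^ j) (hP1 j)
  rw [hW]
  ext n
  simpa using congrFun hc n

end ODE

end Summit.BirchSwinnertonDyer.BirchSwinnertonDyer.Theorems.KatzLineDescent

end
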